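import Mathlib
import HarnessLib
import Summits.HubbardSuperconductivity.HubbardSuperconductivity.Theorems.KLProgrammeKLRegimeEnginePairTransferGridSmearing
import Summits.HubbardSuperconductivity.HubbardSuperconductivity.Theorems.KLProgrammeKLRegimeEngineV8PairTransferRelBarIdx

/-!
# Route `KLProgramme` — ENGINE child gen 8 (stmt-HubbardSuperconductivity-20437 `KLRegimeEngineV17F2`), skeleton v2 class #5 rev 3: the `κD` rows of the GRID-currency producer DISCHARGED —
# `klmg_mass_eq_klScale_mul_klSoftMass`, **`klmg_isGramBoundedR_gridSub_of_klSoftMass_le`**, **`klmg_isGramBoundedR_gridSub_dLine`** (`κD² = Λₙ·klIdxMass n j′`: MASS-sensitive with the scale gain)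
# (cell gate-hubbard-kl, seat hubbard-kl-k3c1-p1 g14, technique «composed-map remainder propagation»; composes p1's `klSoftMass` / `klSoftMass_compl_sub_compl_le_klIdxMass` with row 45)

WHY.  Row 48 (`pairTransferStep7_of_analytic_grid`) asks per pair for the Gram constant `κD` of the grid pullback of the `D`-line `softCovOf K_{n+1} (s_{n+1,j} − s_{n+1,j′})`, and its BASE clause for
the same at scale `0`.  By row 45 (`klmg_isGramBoundedR_gridSub_softCovOf_of_mass_le`) this is the MASS `(βL²)⁻¹Σ_k |φ(k)|/ρ_K(k)`; and p1's SOFT MASS is exactly that mass per unit scale: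
`klSoftMass K n φ = (Λₙ·βL²)⁻¹·Σ_k |φ(k)|·‖ĝ_K(k)‖`, `‖ĝ_K(k)‖ = 1/ρ_K(k)` (`norm_propCT_eq`) ⇒ MASS = `Λₙ·klSoftMass K n φ`.  Hence:
* **`klmg_isGramBoundedR_gridSub_of_klSoftMass_le`** — `klSoftMass K n φ ≤ m ⇒ IsGramBoundedR (Sᵀ·softCovOf K φ·S) √(Λₙ·m)` (any grid, `0 < β`, `0 ≤ m`);
* **`klmg_isGramBoundedR_gridSub_dLine`** — with p1's `klSoftMass_compl_sub_compl_le_klIdxMass` (`FrameOK`, `klBetaMin ≤ β ≤ L`, `n ≤ j′ ≤ j`):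
  `IsGramBoundedR (Sᵀ·softCovOf K (s_{n,j} − s_{n,j′})·S) √(Λₙ·klIdxMass n j′)` — in row 48 take `κD := √(Λ_{n+1}·klIdxMass (n+1) j′)` (STEP) and `κD := √(Λ₀·klIdxMass 0 j′)` (BASE): the
  `D`-line's Gram constant carries the index mass AND the scale `Λ` (g13's pricing «κ² ∝ Λₙ·klIdxMass n j′», now a theorem in the sound currency).
After rows 49 (γ) and 50 (κD) the GRID inputs of row 48 are only the pinned grid kernel norms `N_g` of `Gg(Λ(t))` / `NH` of the BASE carrier [class #1 / scale-0 lane] + numbers.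
Composition; nothing else about the model is asserted; nothing asserts (X).3, (c), K3 or superconductivity.  0 kit · 0 lit.
-/

noncomputable section

namespace Summit.HubbardSuperconductivity.HubbardSuperconductivity.Theorems.KLRegimeSplit

set_option linter.dupNamespace false -- summit = problem name (single-conjunct summit), D-0017

open Finset Matrix Set Literature.MathematicalPhysics.QuantumLattice Literature.Probability.LatticeModels GrassmannAlgebra
open Summit.HubbardSuperconductivity.HubbardSuperconductivity.Theorems.KLProgrammeLegKernels
open Summit.HubbardSuperconductivity.HubbardSuperconductivity.Theorems.TwoPointAssembly
open Summit.HubbardSuperconductivity.HubbardSuperconductivity.Theorems.DispersionFlow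
open Summit.HubbardSuperconductivity.HubbardSuperconductivity.Theorems.KLRegimeWick
open Summit.HubbardSuperconductivity.HubbardSuperconductivity.Theorems.EngineV8

variable (L M : ℕ) [NeZero L]

/-- **The phase-space mass of a symbol is `Λₙ` times its soft mass at scale `n`**: `(βL²)⁻¹·Σ_k |φ(k)|/ρ_K(k) = Λₙ·klSoftMass K n φ` (`‖ĝ_K‖ = 1/ρ_K`). -/
theorem klmg_mass_eq_klScale_mul_klSoftMass {β : ℝ} (hβ : 0 < β) (μ : ℝ) (K : TrigPolyC4v) (n : ℕ) (φ : FreqMomentum L M → ℝ) :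
    1 / (β * (L : ℝ) ^ 2) * ∑ k : FreqMomentum L M, |φ k| / Real.sqrt (matsubaraFreq β M k.1 ^ 2 + nambuXiCT L μ K k.2 ^ 2) =
      klScale klE0 n * klSoftMass L M β μ K n φ := by
  have hL : (0 : ℝ) < L := by exact_mod_cast Nat.pos_of_ne_zero (NeZero.ne L)
  have hΛ : 0 < klScale klE0 n := klth_klScale_pos n
  have hβL2 : 0 < β * (L : ℝ) ^ 2 := by positivity
  unfold klSoftMass
  have hsum : ∑ k : FreqMomentum L M, |φ k| / Real.sqrt (matsubaraFreq β M k.1 ^ 2 + nambuXiCT L μ K k.2 ^ 2) =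
      ∑ k : FreqMomentum L M, |φ k| * ‖propCT L M β μ K k‖ :=
    Finset.sum_congr rfl fun k _ => by rw [norm_propCT_eq, div_eq_mul_inv]
  rw [hsum, mul_inv, ← mul_assoc, ← mul_assoc, mul_inv_cancel₀ hΛ.ne', one_mul, one_div]

/-- **`klmg_isGramBoundedR_gridSub_of_klSoftMass_le`** — a soft-mass bound IS a grid Gram constant: `klSoftMass K n φ ≤ m ⇒ IsGramBoundedR (Sᵀ·softCovOf K φ·S) √(Λₙ·m)`. -/
theorem klmg_isGramBoundedR_gridSub_of_klSoftMass_le [NeZero M] {β : ℝ} (hβ : 0 < β) (μ : ℝ) (K : TrigPolyC4v) (Ng n : ℕ) (φ : FreqMomentum L M → ℝ) {m : ℝ}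
    (hm0 : 0 ≤ m) (hm : klSoftMass L M β μ K n φ ≤ m) :
    IsGramBoundedR ((hubbardGridSub L M β Ng).transpose * softCovOf L M β μ K φ * hubbardGridSub L M β Ng) (Real.sqrt (klScale klE0 n * m)) := by
  have hΛ : 0 < klScale klE0 n := klth_klScale_pos n
  refine klmg_isGramBoundedR_gridSub_softCovOf_of_mass_le L M hβ μ K Ng φ (Real.sqrt_nonneg _) ?_
  rw [Real.sq_sqrt (mul_nonneg hΛ.le hm0), klmg_mass_eq_klScale_mul_klSoftMass L M hβ μ K n φ]
  exact mul_le_mul_of_nonneg_left hm hΛ.le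

/-- **`klmg_isGramBoundedR_gridSub_dLine`** — the `κD` rows of row 48 DISCHARGED: for an admissible frame (`FrameOK R U N μ K`), `klBetaMin ≤ β ≤ L`, `n ≤ j′ ≤ j`, any grid,
`IsGramBoundedR (Sᵀ·softCovOf K (s_{n,j} − s_{n,j′})·S) √(Λₙ·klIdxMass n j′)` (`klSoftMass_compl_sub_compl_le_klIdxMass`). -/
theorem klmg_isGramBoundedR_gridSub_dLine [NeZero M] {R : RenConsts} {U : ℝ} {Nsc : ℕ} {μ : ℝ} {K : TrigPolyC4v} (hK : FrameOK R U Nsc μ K)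
    {β : ℝ} (hβ : klBetaMin ≤ β) (hβL : β ≤ L) {n j j' : ℕ} (hn : n ≤ j') (hj : j' ≤ j) (Ng : ℕ) :
    IsGramBoundedR ((hubbardGridSub L M β Ng).transpose * softCovOf L M β μ K (softSymbolCompl L M β μ K n j - softSymbolCompl L M β μ K n j') * hubbardGridSub L M β Ng)
      (Real.sqrt (klScale klE0 n * klIdxMass n j')) :=
  klmg_isGramBoundedR_gridSub_of_klSoftMass_le L M (pos_of_klBetaMin_le hβ) μ K Ng n _ (klIdxMass_nonneg n j')
    (klSoftMass_compl_sub_compl_le_klIdxMass β μ K hK hβ hβL hn hj)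

end Summit.HubbardSuperconductivity.HubbardSuperconductivity.Theorems.KLRegimeSplit

end
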